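import Summits.Ventures.HodgeRepro.Night1DivisorNonvacuity

/-!
# Balanced sets, unions of balanced pairs, and the enumeration of a `2k`-set — the bookkeeping behind the
divisorial ⊕ exceptional decomposition of the joint `(k, k)`-eigenspace

Blind re-derivation cell `pub-hodge-repro`, seat `night-1` (gen 5, fifteenth file).  Imports night-1's
`Night1DivisorNonvacuity` (through it `Night1DivisorialWedge`: the criterion
`coordWedgeOn_mem_divisorPowerIn_iff`, `IsBalancedPairing`, `concatPairs`).

For any family `Ψ : Γ → Finset X` of cocharacters on a finite set and any `k`:

* `cornerCountOn_concatPairs` — the corner count of a concatenation of pairs is the sum over the pairs, so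
  a concatenation of `k` balanced pairs has corner count `k`; hence
  **`divisorPowerIn_le_jointEigenspaceOn`** — products of `k` divisor classes are joint `(k, k)`-classes;
* `IsUnionOfBalancedPairs Ψ k S` — the `2k`-set `S` is the disjoint union of `k` balanced pairs, and
  `isUnionOfBalancedPairs_image_iff` — for injective `u`, `range u` is such a union iff `e_u` is a product
  of `k` divisor classes (the criterion of `Night1DivisorialWedge` restated on sets);
* `balancedSets Ψ k` / `exceptionalSets Ψ k` — the balanced `2k`-sets and those that are NOT unions of
  balanced pairs;
* `enumSet` — an enumeration `Fin 2k → X` of a `2k`-set (injective, with the set as range; made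
  irreducible once its two properties are proved), and `coordWedgeOn_mem_span_of_range_eq` — two injective
  families with the same range have proportional wedges.

`Night1HodgeDecomposition` builds the decomposition `J = D^k ⊔ E^k`, `D^k ⊓ E^k = 0` on these.  Nothing
geometric is built; nothing here says anything about the status of the Hodge conjecture for CM abelian
varieties, which is NOT proved.
-/

set_option autoImplicit false

open Finset Module

namespace HodgeRepro.RouteC

open CMHodgeOn

section Sets

variable {X : Type*} [Fintype X] [DecidableEq X] {Γ : Type*}

/-! ### Counting corners of a concatenation -/

omit [Fintype X] in
/-- The corner count of an appended family is the sum of the corner counts. -/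
theorem cornerCountOn_append (Φ : Finset X) {m n : ℕ} (u : Fin m → X) (v : Fin n → X) :
    cornerCountOn Φ (Fin.append u v) = cornerCountOn Φ u + cornerCountOn Φ v := by
  simp only [cornerCountOn, Finset.card_filter]
  rw [Fin.sum_univ_add]
  simp only [Fin.append_left, Fin.append_right]

omit [Fintype X] in
/-- The corner count of a concatenation of pairs is the sum over the pairs. -/
theorem cornerCountOn_concatPairs (Φ : Finset X) {k : ℕ} (s : Fin k → Fin 2 → X) :
    cornerCountOn Φ (concatPairs s) = ∑ j, cornerCountOn Φ (s j) := by
  induction k with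
  | zero => simp [concatPairs, cornerCountOn]
  | succ k ih =>
    show cornerCountOn Φ (Fin.append (concatPairs fun j => s j.castSucc) (s (Fin.last k))) = _
    rw [cornerCountOn_append, ih, Fin.sum_univ_castSucc]

omit [Fintype X] in
/-- A concatenation of `k` balanced pairs has corner count `k` for every `Ψ γ`. -/
theorem cornerCountOn_concatPairs_of_isBalancedPairing (Ψ : Γ → Finset X) {k : ℕ}
    {s : Fin k → Fin 2 → X} (hs : IsBalancedPairing Ψ s) (γ : Γ) :
    cornerCountOn (Ψ γ) (concatPairs s) = k := by
  rw [cornerCountOn_concatPairs]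
  have h : ∀ j, cornerCountOn (Ψ γ) (s j) = 1 := fun j => by
    rw [cornerCountOn_eq_card_inter _ (hs j).1]
    exact (hs j).2 γ
  simp [h]

/-- **Products of `k` divisor classes are joint `(k, k)`-classes.** -/
theorem divisorPowerIn_le_jointEigenspaceOn (Ψ : Γ → Finset X) (k : ℕ) :
    divisorPowerIn Ψ k ≤ jointEigenspaceOn Ψ (2 * k) k := by
  intro ω hω
  rw [mem_divisorPowerIn_iff, divisorPower_eq_span] at hω
  have hP : ∃ ω' : ⋀[ℂ]^(2 * k) (X → ℂ),
      (ω' : ExteriorAlgebra ℂ (X → ℂ)) = (ω : ExteriorAlgebra ℂ (X → ℂ)) ∧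
        ω' ∈ jointEigenspaceOn Ψ (2 * k) k := by
    refine Submodule.span_induction (p := fun x _ => ∃ ω' : ⋀[ℂ]^(2 * k) (X → ℂ),
      (ω' : ExteriorAlgebra ℂ (X → ℂ)) = x ∧ ω' ∈ jointEigenspaceOn Ψ (2 * k) k) ?_ ?_ ?_ ?_ hω
    · intro x hx
      obtain ⟨f, hf⟩ := Set.mem_pow.1 hx
      have hf' : ∀ j : Fin k, ∃ s : Fin 2 → X, Function.Injective s ∧
          (∀ γ, (univ.image s ∩ Ψ γ).card = 1) ∧
            (coordWedgeOn 2 s : ExteriorAlgebra ℂ (X → ℂ)) = (f j : ExteriorAlgebra ℂ (X → ℂ)) := by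
        intro j
        obtain ⟨ω₂, ⟨s, hs, hbal, hω₂⟩, hx₂⟩ := (f j).2
        exact ⟨s, hs, hbal, by rw [← hx₂, ← hω₂]; rfl⟩
      choose s hs hbal hfs using hf'
      refine ⟨coordWedgeOn (2 * k) (concatPairs s), ?_, ?_⟩
      · rw [← hf, ← prod_ofFn_coordWedgeOn]
        congr 2
        funext j
        exact hfs j
      · rw [mem_jointEigenspaceOn_iff]
        intro γ lam
        rw [map_cocharOn_coordWedgeOn,
          cornerCountOn_concatPairs_of_isBalancedPairing Ψ (fun j => ⟨hs j, hbal j⟩) γ]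
    · exact ⟨0, by simp, Submodule.zero_mem _⟩
    · rintro x y _ _ ⟨ω₁, h₁, h₁'⟩ ⟨ω₂, h₂, h₂'⟩
      exact ⟨ω₁ + ω₂, by simp [h₁, h₂], Submodule.add_mem _ h₁' h₂'⟩
    · rintro a x _ ⟨ω₁, h₁, h₁'⟩
      exact ⟨a • ω₁, by simp [h₁], Submodule.smul_mem _ _ h₁'⟩
  obtain ⟨ω', h₁, h₂⟩ := hP
  rw [← Subtype.ext h₁]
  exact h₂

/-! ### Unions of balanced pairs, balanced sets, exceptional sets -/

omit [Fintype X] in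
/-- `S` is the disjoint union of `k` balanced pairs. -/
def IsUnionOfBalancedPairs (Ψ : Γ → Finset X) (k : ℕ) (S : Finset X) : Prop :=
  ∃ s : Fin k → Fin 2 → X, IsBalancedPairing Ψ s ∧ Function.Injective (concatPairs s) ∧
    univ.image (concatPairs s) = S

omit [Fintype X] in
/-- An injective family with the same range as a `2k`-set enumeration is a permutation of it: the
concatenation of a balanced pairing covering the range of an injective `u` is injective. -/
theorem concatPairs_injective_of_range_eq {k : ℕ} {u : Fin (2 * k) → X} (hu : Function.Injective u)
    {s : Fin k → Fin 2 → X} (hrange : Set.range (concatPairs s) = Set.range u) :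
    Function.Injective (concatPairs s) := by
  have h1 : (univ.image (concatPairs s)) = univ.image u := by
    ext x
    simp only [mem_image, mem_univ, true_and]
    constructor
    · rintro ⟨b, rfl⟩
      have : concatPairs s b ∈ Set.range u := by
        rw [← hrange]
        exact Set.mem_range_self b
      exact this
    · rintro ⟨a, rfl⟩
      have : u a ∈ Set.range (concatPairs s) := by
        rw [hrange]
        exact Set.mem_range_self a
      exact this
  have h2 : (univ.image (concatPairs s)).card = (univ : Finset (Fin (2 * k))).card := by
    rw [h1, card_image_of_injective _ hu]
  have h3 := Finset.card_image_iff.1 h2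
  rw [Finset.coe_univ] at h3
  exact Set.injOn_univ.1 h3

/-- For an injective `u`, `range u` is a union of balanced pairs iff `e_u` is a product of divisor
classes. -/
theorem isUnionOfBalancedPairs_image_iff (Ψ : Γ → Finset X) {k : ℕ} {u : Fin (2 * k) → X}
    (hu : Function.Injective u) :
    IsUnionOfBalancedPairs Ψ k (univ.image u) ↔ coordWedgeOn (2 * k) u ∈ divisorPowerIn Ψ k := by
  rw [coordWedgeOn_mem_divisorPowerIn_iff Ψ hu]
  constructor
  · rintro ⟨s, hs, _, himg⟩
    refine ⟨s, hs, ?_⟩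
    have h := congrArg (fun S : Finset X => (S : Set X)) himg
    simp only [coe_image, coe_univ, Set.image_univ] at h
    exact h
  · rintro ⟨s, hs, hrange⟩
    refine ⟨s, hs, concatPairs_injective_of_range_eq hu hrange, ?_⟩
    rw [← coe_inj, coe_image, coe_univ, Set.image_univ, hrange, ← Set.image_univ, ← coe_univ,
      ← coe_image]

omit [Fintype X] in
/-- The balanced `2k`-sets: `2k` points, exactly `k` of them in every `Ψ γ`. -/
def balancedSets (Ψ : Γ → Finset X) (k : ℕ) : Set (Finset X) :=
  {S | S.card = 2 * k ∧ ∀ γ, (S ∩ Ψ γ).card = k}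

omit [Fintype X] in
/-- The exceptional `2k`-sets: balanced but not a union of balanced pairs. -/
def exceptionalSets (Ψ : Γ → Finset X) (k : ℕ) : Set (Finset X) :=
  {S | S ∈ balancedSets Ψ k ∧ ¬ IsUnionOfBalancedPairs Ψ k S}

omit [Fintype X] in
/-- A balanced set has `2k` elements. -/
theorem card_of_mem_balancedSets {Ψ : Γ → Finset X} {k : ℕ} {S : Finset X}
    (h : S ∈ balancedSets Ψ k) : S.card = 2 * k := h.1

omit [Fintype X] in
/-- An exceptional set is balanced. -/
theorem mem_balancedSets_of_mem_exceptionalSets {Ψ : Γ → Finset X} {k : ℕ} {S : Finset X}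
    (h : S ∈ exceptionalSets Ψ k) : S ∈ balancedSets Ψ k := h.1

omit [Fintype X] in
/-- An exceptional set is not a union of balanced pairs. -/
theorem not_isUnionOfBalancedPairs_of_mem_exceptionalSets {Ψ : Γ → Finset X} {k : ℕ} {S : Finset X}
    (h : S ∈ exceptionalSets Ψ k) : ¬ IsUnionOfBalancedPairs Ψ k S := h.2

/-! ### Enumerating a `2k`-set -/

omit [Fintype X] in
/-- An enumeration of a `2k`-set. -/
noncomputable def enumSet (k : ℕ) (S : Finset X) (h : S.card = 2 * k) : Fin (2 * k) → X :=
  fun a => (S.equivFinOfCardEq h).symm a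

omit [Fintype X] [DecidableEq X] in
/-- The enumeration is injective. -/
theorem enumSet_injective (k : ℕ) (S : Finset X) (h : S.card = 2 * k) :
    Function.Injective (enumSet k S h) := by
  intro a b hab
  exact (S.equivFinOfCardEq h).symm.injective (Subtype.ext hab)

omit [Fintype X] in
/-- The image of the enumeration is the set. -/
theorem image_enumSet (k : ℕ) (S : Finset X) (h : S.card = 2 * k) :
    univ.image (enumSet k S h) = S := by
  ext x
  simp only [mem_image, mem_univ, true_and, enumSet]
  constructor
  · rintro ⟨a, rfl⟩
    exact ((S.equivFinOfCardEq h).symm a).2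
  · intro hx
    exact ⟨S.equivFinOfCardEq h ⟨x, hx⟩, by simp⟩

omit [Fintype X] in
/-- The range of the enumeration is the set. -/
theorem range_enumSet (k : ℕ) (S : Finset X) (h : S.card = 2 * k) :
    Set.range (enumSet k S h) = ↑S := by
  have : (↑(univ.image (enumSet k S h)) : Set X) = Set.range (enumSet k S h) := by
    rw [coe_image, coe_univ, Set.image_univ]
  rw [← this, image_enumSet]

attribute [irreducible] enumSet

omit [Fintype X] in
/-- Two injective families with the same range have proportional wedges: `e_u ∈ span {e_v}`. -/
theorem coordWedgeOn_mem_span_of_range_eq {n : ℕ} {u v : Fin n → X} (hu : Function.Injective u)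
    (hrange : Set.range v = Set.range u) :
    coordWedgeOn n u ∈ Submodule.span ℂ {coordWedgeOn n v} := by
  obtain ⟨σ, hσ⟩ : ∃ σ : Equiv.Perm (Fin n), u = v ∘ σ := by
    have hbij : ∀ a, ∃ b, v b = u a := by
      intro a
      have : u a ∈ Set.range v := by
        rw [hrange]
        exact Set.mem_range_self a
      exact this
    choose g hg using hbij
    have hginj : Function.Injective g := fun a b hab => hu (by rw [← hg a, ← hg b, hab])
    refine ⟨Equiv.ofBijective g ((Fintype.bijective_iff_injective_and_card g).2 ⟨hginj, rfl⟩), ?_⟩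
    funext a
    simp only [Function.comp_apply, Equiv.ofBijective_apply, hg]
  rw [hσ]
  unfold coordWedgeOn
  rw [show (fun i => coordVecOn ((v ∘ σ) i)) = (fun i => coordVecOn (v i)) ∘ σ from rfl,
    AlternatingMap.map_perm, Units.smul_def, Submodule.mem_span_singleton]
  exact ⟨_, rfl⟩

end Sets

end HodgeRepro.RouteC
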